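import Literature.IUT.HodgeTheaters.PMBaseBridgePropsProofs5
import Literature.IUT.HodgeTheaters.PMBaseDischarge
import Literature.IUT.HodgeTheaters.PMBaseNegCompatSub
import Literature.IUT.HodgeTheaters.ThetaPMEllHodgeTheatersProofs

/-!
# Proofs over [IUTchI] Prop 6.8 (i) / Rmk 6.12.1: the `𝔽_l^{⋊±}`-symmetry is NOT a consequence of the base interface

Mochizuki, *Inter-universal Teichmüller theory I*, §6, Proposition 6.8 (i) pp. 167–168 and Remark 6.12.1
p. 174, kurims manuscript (May 2020). PROOF-ONLY companion (theorems, no definitions) to abc-iut-L5-t4's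
`PMBaseProcessions.lean` (`DThetaPMEllHT.EllBridgeSymmetry`, FACT-LIST row F-2034) and
`ThetaPMEllHodgeTheaters.lean` (`FKit.FunctorialDynamicsPM`, row F-2048), by abc-iut-L5-t7.

**Independence witness for Prop 6.8 (i) itself** (`DThetaPMEllHT.exists_kit_not_ellBridgeSymmetry`): for
every prime `l ≠ 2` there is a base kit `K : PMBaseKit l` with TWO valuations — abc-iut-L5-t4's toy collage kit
at each place, with `φ^{Θell}_{•,v}` the identity of `AGL₁(𝔽_l)` at one place and the TRANSLATION `z ↦ z + 1`
at the other, all interface clauses holding — over which the model `𝒟-Θ^{±ell}`-Hodge theater `Ex62.ht K`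
(Examples 6.2 (i), 6.3 (i)) violates `EllBridgeSymmetry`: its underlying `𝒟-Θ^{ell}`-bridge has only `l`, not
`2·l`, automorphisms.  Mechanism: by abc-iut-L5-t13's rigidity (`DThetaEllBridge.isoTorsor_injective`) the
count `2·|T|` forces an automorphism with NEGATIVE index bijection `z ↦ −z`; reading its compatibility square
on `±`-label classes (`DThetaEllBridge.Iso.zeta_trans_gLabMap`) at the labels `(t, v) = (0, transl)` and
`(1, id)` makes the SAME global component act on the cusp `1` as `1 ↦ 1` and as `1 ↦ −1`, i.e. `2 = 0` in
`𝔽_l`.  (The ONE-place translation kit of `Ex63.exists_kit_not_equivariant` does not work: there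
`(2, −1) ∈ AGL₁(𝔽_l)` realises the negative automorphism — the obstruction is the place-INDEPENDENCE of the
global component.)  Consequently neither F-2034 `EllBridgeSymmetry` nor F-2048 `FunctorialDynamicsPM` (which
is `EllBridgeSymmetry` for the base theater of every Θ^{±ell}-Hodge theater; every base theater lifts to the
identity `ℱ`-kit, `FKit.exists_thetaPMEllHT_dHT_eq`) holds as a universal closure over the interface
(`not_forall_…`); both are SCHEMAS, holding in instance form exactly where the `[−1]`-compatibility of
`φ^{Θell}_{•,v}` (`Ex63.NegCompatModel`, Example 6.3 (ii)) does — e.g. abc-iut-L5-t4's `toyKit`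
(`FKit.functorialDynamicsPM_of_negCompatModel`, `FKit.functorialDynamicsPM_toy`).
Record only; [claim: Mochizuki2012, status: disputed]; refuting a universal closure over an interface is not a
statement about the printed claim for the genuine objects; nothing here takes a side on any disputed step.
-/

namespace Literature.IUT.HodgeTheaters

open CategoryTheory

universe u

namespace PMBaseKit

/-! ### Prop 6.8 (i) fails over a two-place toy kit -/

/-- **[IUTchI] Prop 6.8 (i) is independent of the base interface**: a kit with two valuations over which
the model `𝒟-Θ^{±ell}`-Hodge theater `(𝔇_≻ ⟵ 𝔇_± ⟶ 𝒟^{⊚±})` of Examples 6.2 (i) / 6.3 (i) does NOT satisfy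
`EllBridgeSymmetry` (its underlying `𝒟-Θ^{ell}`-bridge admits no automorphism with negative index bijection).
[claim: Mochizuki2012, status: disputed] -/
theorem DThetaPMEllHT.exists_kit_not_ellBridgeSymmetry (l : ℕ) [Fact l.Prime] (hl : l ≠ 2) :
    ∃ K : PMBaseKit.{0} l, Nonempty K.V ∧ ∃ H : K.DThetaPMEllHT, ¬ EllBridgeSymmetry H := by
  classical
  haveI : NeZero l := ⟨(Fact.out : l.Prime).ne_zero⟩
  -- the translation `z ↦ z + 1` of `AGL₁(𝔽_l)`
  let φ₁ : Model.AGL l := ⟨Multiplicative.ofAdd 1, 1⟩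
  have hφ₁ : ∀ z : ZMod l, Model.aglPerm l φ₁ z = z + 1 := fun z => by
    change ((1 : (ZMod l)ˣ) : ZMod l) * z + (Multiplicative.ofAdd (1 : ZMod l)).toAdd = z + 1
    simp
  let T : PMBaseKit.{0} l := PMBaseKit.toyKit l hl
  -- the toy kit at each of TWO places `𝕍 = Bool`, with `φ^{Θell}` the identity at `false`, `φ₁` at `true`
  let K : PMBaseKit.{0} l :=
    { PMBaseKit.toyKit l hl with
      V := Bool
      decEqV := inferInstanceAs (DecidableEq Bool)
      bad := ∅
      arc := ∅
      Amb := fun _ => T.Amb ()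
      catAmb := fun _ => T.catAmb ()
      model := fun _ => T.model ()
      pmObj := fun _ => T.pmObj ()
      toPM := fun _ => T.toPM ()
      LabCuspPM := fun _ => T.LabCuspPM ()
      labPM := fun _ => T.labPM ()
      labMap := fun _ => T.labMap ()
      labMap_refl := fun _ => T.labMap_refl ()
      labMap_trans := fun _ => T.labMap_trans ()
      labMap_charts := fun _ => T.labMap_charts ()
      exists_negative := fun _ => T.exists_negative ()
      atV := fun _ => T.atV ()
      phiEll := fun v => bif v then φ₁ else T.phiEll ()
      labOfHom := fun _ => T.labOfHom ()
      labOfHom_pre := fun _ => T.labOfHom_pre ()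
      labOfHom_post := fun _ => T.labOfHom_post ()
      labOfHom_phiEll_bijective := fun v => by
        cases v
        · exact T.labOfHom_phiEll_bijective ()
        · exact (Model.homPerm l (X := .loc) (Y := .glob) φ₁).bijective
      labOfHom_phiEll_charts := fun v => by
        cases v
        · exact T.labOfHom_phiEll_charts ()
        · rintro e ⟨ε, rfl⟩
          refine ⟨FlPM.mk (-(ε • (1 : ZMod l))) ε, ?_⟩
          ext z
          change (FlPM.mk (l := l) _ ε) • z = ε • (Equiv.ofBijective _ _).symm z
          generalize hw : (Equiv.ofBijective _ _).symm z = w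
          rw [Equiv.symm_apply_eq] at hw
          change z = Model.homPerm l (X := .loc) (Y := .glob) φ₁ w at hw
          have hw' : z = w + 1 := by rw [hw]; exact hφ₁ w
          subst hw'
          simp only [FlPM.mk_smul, smul_add]
          abel }
  have hV : Nonempty K.V := ⟨true⟩
  refine ⟨K, hV, Ex62.ht K, fun hsym => ?_⟩
  -- notation and basic values in `K`
  have hchart : ∀ z : ZMod l, K.gChart₀ z = z := fun z => by
    change FlPM.toPerm l 1 z = z
    simp
  have hchart' : ∀ z : ZMod l, K.gChart₀.symm z = z := fun z => by
    rw [Equiv.symm_apply_eq]; exact (hchart z).symm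
  -- what `φ^{Θell}_{•,v}` does on `±`-label classes of cusps, as a map `𝔽_l → 𝔽_l`
  let lab : K.V → ZMod l → ZMod l := fun v z => K.labOfHom v (K.phiEll v) z
  have hphi1 : ∀ z : ZMod l, lab true z = z + 1 := hφ₁
  have hphi0 : ∀ z : ZMod l, lab false z = z := fun z => by
    change Model.aglPerm l 1 z = z
    rw [map_one]
    rfl
  have hneg : ∀ (v : K.V) (z : ZMod l), labNeg (K.isLocal_model v) z = -z := by
    intro v z
    obtain ⟨ε, hε⟩ : ∃ ε : ℤˣ, signPerm l ε = (K.labPM v (K.model v) (K.isLocal_model v)).chart₀ :=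
      (K.labPM v (K.model v) (K.isLocal_model v)).chart₀_mem
    change ((K.labPM v (K.model v) (K.isLocal_model v)).chart₀.trans ((signPerm l (-1)).trans
      (K.labPM v (K.model v) (K.isLocal_model v)).chart₀.symm)) z = -z
    rw [← hε]
    change (signPerm l ε).symm (signPerm l (-1) (signPerm l ε z)) = -z
    rw [Equiv.symm_apply_eq]
    simp [Units.smul_def, smul_neg]
  -- the underlying `𝒟-Θ^{ell}`-bridge of the model theater and its induced bijections `ζ^{Θell}_{v_s}`
  set B : K.DThetaEllBridge := (Ex62.ht K).ellBridge with hB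
  have hζval : ∀ (s : ZMod l) (v : K.V) (ζ : K.LabCuspPM v ((B.capsule s).obj v) ≃ K.GLab B.glob),
      B.ZetaSpec s v ζ → ∀ z : ZMod l, ζ z = lab v z + s := by
    intro s v ζ hζ z
    obtain ⟨b, hb⟩ := Ex63.lifts_nonempty (K := K) (FlPM.transl s)
    have hf : K.phiEll v ≫ (K.atV v).map b.hom ∈ B.poly s v :=
      ⟨1, one_mem _, b, hb, by change _ = 𝟙 _ ≫ _; exact (Category.id_comp _).symm⟩
    have h1 : K.labOfHom v (K.phiEll v ≫ (K.atV v).map b.hom) z = ζ z := congrFun (hζ.1 _ hf) z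
    rw [K.labOfHom_post v (K.phiEll v) b] at h1
    rw [← h1]
    change K.gLabMap b (lab v z) = _
    rw [hb.2]
    simp only [Equiv.trans_apply, FlPM.toPerm_apply, FlPM.transl_smul, hchart, hchart']
  -- Step 1: the count `2·|T|` forces an automorphism with index bijection `z ↦ −z`
  have hl2 : 2 < l := DThetaPMEllHT.two_lt_of_nonempty hV (Ex62.ht K)
  obtain ⟨-, hcard⟩ := hsym hV
  change Nat.card (DThetaEllBridge.Iso B B) = 2 * Nat.card (ZMod l) at hcard
  rw [Nat.card_zmod] at hcard
  have hS : Nat.card {ι : B.T ≃ B.T // B.torT.Compat B.torT ι} = 2 * l := by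
    change Nat.card {f : B.T ≃ B.T // ∀ e' ∈ B.torT.charts, f.trans e' ∈ B.torT.charts} = _
    exact B.torT.card_isIso B.torT hl2
  haveI : Finite {ι : B.T ≃ B.T // B.torT.Compat B.torT ι} := by
    apply Nat.finite_of_card_ne_zero
    rw [hS]
    omega
  have hbij := (DThetaEllBridge.isoTorsor_injective hV B B).bijective_of_nat_card_le
    (by rw [hS, hcard])
  -- the negative index bijection `κ₀ : z ↦ −z` is compatible with the torsor structure of `T = 𝔽_l`
  let κ₀ : ZMod l ≃ ZMod l := FlPM.toPerm l (FlPM.mk 0 (-1))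
  have hκ₀val : ∀ t : ZMod l, κ₀ t = -t := fun t => by
    change FlPM.mk (l := l) 0 (-1) • t = -t
    simp only [FlPM.mk_smul, Units.smul_def, Units.val_neg, Units.val_one, neg_smul, one_smul, add_zero]
  have hκ₀ : B.torT.Compat B.torT κ₀ := by
    rintro e' ⟨e, ⟨ε, rfl⟩, g, rfl⟩
    refine ⟨signPerm l ε, ⟨ε, rfl⟩, g * FlPM.mk 0 (-1), ?_⟩
    ext z
    change FlPM.toPerm l g (signPerm l ε (FlPM.toPerm l (FlPM.mk 0 (-1)) z)) =
      FlPM.toPerm l (g * FlPM.mk 0 (-1)) (signPerm l ε z)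
    rw [map_mul, Equiv.Perm.mul_apply]
    simp only [FlPM.toPerm_apply, signPerm_apply, FlPM.mk_smul, add_zero, smul_smul, mul_comm ε]
  obtain ⟨g, hg⟩ := hbij.2 ⟨κ₀, hκ₀⟩
  have hκ : ∀ t, g.indexEquiv t = κ₀ t := fun t => by
    have h := congrArg Subtype.val hg
    exact congrFun (congrArg (fun e : ZMod l ≃ ZMod l => (e : ZMod l → ZMod l)) h) t
  -- Step 2: read the compatibility square of `g` on `±`-label classes at `(0, true)` and `(1, false)`
  obtain ⟨ψ, hψ⟩ := g.globPoly_orbit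
  have hψmem : ψ ∈ g.globPoly := by
    rw [hψ]
    exact ⟨1, one_mem _, (Iso.trans_refl _).symm⟩
  have key : ∀ (t : ZMod l) (v : K.V), K.gLabMap ψ (lab v 0 + t) = lab v 0 + κ₀ t := by
    intro t v
    obtain ⟨φ, hφ⟩ := g.capsPoly_plusFull t
    obtain ⟨ζ₁, hζ₁⟩ := DThetaEllBridge.inducesZeta B t v
    obtain ⟨ζ₂, hζ₂⟩ := DThetaEllBridge.inducesZeta B (g.indexEquiv t) v
    -- the `v`-constituent of `φ`, viewed as an automorphism of the model `𝒟_v`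
    let φv : K.model v ≅ K.model v := φ v
    have h : K.gLabMap ψ (ζ₁ (0 : ZMod l)) = ζ₂ (K.labMap v φv (0 : ZMod l)) :=
      DFunLike.congr_fun (DThetaEllBridge.Iso.zeta_trans_gLabMap g t v hφ hψmem hζ₁ hζ₂) (0 : ZMod l)
    -- `φ_v` acts on `±`-label classes by `±1`, fixing the label `0`
    have h0 : K.labMap v φv (0 : ZMod l) = (0 : ZMod l) := by
      rcases labMap_eq_refl_or_labNeg (K.isLocal_model v) φv with hφv | hφv
      · rw [hφv]; rfl
      · rw [hφv, hneg, neg_zero]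
    rw [hζval t v ζ₁ hζ₁ 0, h0, hζval (g.indexEquiv t) v ζ₂ hζ₂ 0, hκ t] at h
    exact h
  have k1 := key 0 true
  have k2 := key 1 false
  rw [hphi1, hκ₀val, neg_zero, add_zero, zero_add] at k1
  rw [hphi0, hκ₀val, zero_add, zero_add] at k2
  -- `ψ` maps the cusp `1` both to `1` and to `−1`
  have h2 : (1 : ZMod l) = -1 := k1.symm.trans k2
  exact two_ne_zero_of_isLocal (K.isLocal_model true) (by linear_combination h2)

/-- **F-2034 is a schema, not a fact**: the universal closure of abc-iut-L5-t4's named statement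
`DThetaPMEllHT.EllBridgeSymmetry` ([IUTchI] Prop 6.8 (i)) over the base interface is FALSE (witness at
`l = 3`). Its instance form holds over every kit with the `[−1]`-compatibility of Example 6.3 (ii)
(abc-iut-L5-t13's `DThetaPMEllHT.ellBridgeSymmetry_of_negCompat`). [claim: Mochizuki2012, status: disputed] -/
theorem DThetaPMEllHT.not_forall_ellBridgeSymmetry :
    ¬ ∀ (l : ℕ) (K : PMBaseKit.{0} l) (H : K.DThetaPMEllHT), EllBridgeSymmetry H := by
  intro h
  haveI : Fact (Nat.Prime 3) := ⟨Nat.prime_three⟩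
  obtain ⟨K, -, H, hH⟩ := DThetaPMEllHT.exists_kit_not_ellBridgeSymmetry 3 (by decide)
  exact hH (h 3 K H)

/-! ### Rmk 6.12.1: every base theater lifts to the identity `ℱ`-kit -/

/-- **Every `𝒟-Θ^{±ell}`-Hodge theater is the associated base theater of a Θ^{±ell}-Hodge theater** over the
IDENTITY `ℱ`-kit of the base kit (all Frobenioid-side ambient categories equal to the base ones, `𝔉 ↦ 𝔇` the
identity; `𝒟^⊢`-side trivial) — so `FKit.FunctorialDynamicsPM` ([IUTchI] Rmk 6.12.1) for that kit is literally
Prop 6.8 (i) for ALL base theaters. [claim: Mochizuki2012, status: disputed] -/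
theorem FKit.exists_thetaPMEllHT_dHT_eq {l : ℕ} (K : PMBaseKit.{0} l) (H₀ : K.DThetaPMEllHT) :
    ∃ (M : K.MultKit) (FK : K.FKit M) (H : FK.ThetaPMEllHT), H.dHT = H₀ := by
  let M : K.MultKit :=
    { DMono := SingleObj Unit
      mono := fun _ => SingleObj.star _
      monoMap := fun _ => 𝟙 _
      thetaPolyBad := fun _ _ _ => ∅ }
  let FK : K.FKit M :=
    { FAmb := K.Amb
      fModel := K.model
      FmAmb := K.Amb
      fmModel := K.model
      toD := fun _ => 𝟭 _
      toD_model := fun _ => Iso.refl _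
      toFm := fun _ => 𝟭 _
      toFm_model := fun _ => Iso.refl _
      RlfAmb := ∀ v, K.Amb v
      rlfModel := K.model
      rlfFm := fun v => Pi.eval _ v
      rlfOf := fun F => F
      rlfOfMap := fun φ => Pi.isoMk φ
      rlfFm_rlfOf := fun _ _ => Iso.refl _
      ThAmb := K.Amb
      thModel := K.model
      thToF := fun _ => 𝟭 _
      thToF_model := fun _ => Iso.refl _
      toDm := fun _ => SingleObj.star _
      toDmMap := fun _ => 𝟙 _
      toDm_toFm := fun _ _ => ⟨𝟙 _⟩ }
  refine ⟨M, FK,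
    { T := H₀.T
      grpT := H₀.grpT
      capsule := fun t => ⟨(H₀.capsule t).obj, (H₀.capsule t).isLocal⟩
      codomain := ⟨H₀.codomain.obj, H₀.codomain.isLocal⟩
      glob := H₀.glob
      dPolyPM := H₀.polyPM
      dPolyEll := H₀.polyEll
      exists_model := H₀.exists_model }, rfl⟩

/-- **F-2048 refuted as a universal closure**: for every prime `l ≠ 2` there are a base kit and an `ℱ`-kit
over it violating `FKit.FunctorialDynamicsPM` ([IUTchI] Rmk 6.12.1: Prop 6.8 (i) for the associated base
theater of every Θ^{±ell}-Hodge theater). [claim: Mochizuki2012, status: disputed] -/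
theorem FKit.exists_fkit_not_functorialDynamicsPM (l : ℕ) [Fact l.Prime] (hl : l ≠ 2) :
    ∃ (K : PMBaseKit.{0} l) (M : K.MultKit) (FK : K.FKit M), ¬ FK.FunctorialDynamicsPM := by
  obtain ⟨K, -, H₀, hH₀⟩ := DThetaPMEllHT.exists_kit_not_ellBridgeSymmetry l hl
  obtain ⟨M, FK, H, hH⟩ := FKit.exists_thetaPMEllHT_dHT_eq K H₀
  exact ⟨K, M, FK, fun h => hH₀ (hH ▸ h H)⟩

/-- **F-2048 is a schema, not a fact**: the universal closure of abc-iut-L5-t4's named statement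
`FKit.FunctorialDynamicsPM` ([IUTchI] Rmk 6.12.1) over the interfaces `PMBaseKit` / `MultKit` / `FKit` is
FALSE (witness at `l = 3`). [claim: Mochizuki2012, status: disputed] -/
theorem FKit.not_forall_functorialDynamicsPM :
    ¬ ∀ (l : ℕ) (K : PMBaseKit.{0} l) (M : K.MultKit) (FK : K.FKit M), FK.FunctorialDynamicsPM := by
  intro h
  haveI : Fact (Nat.Prime 3) := ⟨Nat.prime_three⟩
  obtain ⟨K, M, FK, hFK⟩ := FKit.exists_fkit_not_functorialDynamicsPM 3 (by decide)
  exact hFK (h 3 K M FK)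

/-! ### Rmk 6.12.1 in instance form: kits with the `[−1]`-compatibility -/

/-- **[IUTchI] Rmk 6.12.1 — instance form**: over a base kit satisfying the `[−1]`-compatibility of
`φ^{Θell}_{•,v}` (abc-iut-w5-d086's `Ex63.NegCompatModel`, Example 6.3 (ii) p. 161), `FunctorialDynamicsPM`
holds for EVERY `ℱ`-kit (abc-iut-L5-t13's conditional discharge with its hypothesis supplied by name).
[claim: Mochizuki2012, status: disputed] -/
theorem FKit.functorialDynamicsPM_of_negCompatModel {l : ℕ} {K : PMBaseKit.{u} l} {M : K.MultKit}
    (FK : K.FKit M) (h : Ex63.NegCompatModel K) : FK.FunctorialDynamicsPM :=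
  FKit.functorialDynamicsPM_of_equivariant (fun _ hγ => Ex63.NegCompatModel.equivariant h hγ)

/-- **Rmk 6.12.1 holds in abc-iut-L5-t4's consistency model**: `FunctorialDynamicsPM` for the toy `ℱ`-kit
`FKit.toy` over `toyKit` (prime `l ≠ 2`) — the positive half of the schema (the negative half is
`FKit.exists_fkit_not_functorialDynamicsPM`). [claim: Mochizuki2012, status: disputed] -/
theorem FKit.functorialDynamicsPM_toy (l : ℕ) [Fact l.Prime] (hl : l ≠ 2) :
    (FKit.toy l hl).FunctorialDynamicsPM :=
  FKit.functorialDynamicsPM_of_negCompatModel _ (Ex63.negCompatModel_toyKit l hl)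

/-- **Two-sided schema at one prime**: `FunctorialDynamicsPM` holds for some `ℱ`-kit and fails for another
(both over base kits with valuations, prime `l ≠ 2`). [claim: Mochizuki2012, status: disputed] -/
theorem FKit.functorialDynamicsPM_schema (l : ℕ) [Fact l.Prime] (hl : l ≠ 2) :
    (∃ (K : PMBaseKit.{0} l) (M : K.MultKit) (FK : K.FKit M), FK.FunctorialDynamicsPM) ∧
      ∃ (K : PMBaseKit.{0} l) (M : K.MultKit) (FK : K.FKit M), ¬ FK.FunctorialDynamicsPM :=
  ⟨⟨_, _, FKit.toy l hl, FKit.functorialDynamicsPM_toy l hl⟩, FKit.exists_fkit_not_functorialDynamicsPM l hl⟩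

end PMBaseKit

end Literature.IUT.HodgeTheaters
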